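import Summits.PneNP.PneNP.Theorems.DelsarteLasserreCodeSizeLangInNEXP
import Summits.PneNP.PneNP.Theorems.DelsarteLasserreNexpSubsetExp
import Literature.Computability.Complexity.ExpDeterministicCollapseComplement
import Literature.Computability.MetaComplexity.ProofSystems
import Literature.Computability.Complexity.SparseSetsUpwardSeparationNE

/-!
# DECOMPOSITION AUDIT — crux `DelsarteLasserre.Target` (stmt-PneNP-2126), kernel-checked companion of
`STRATEGY-CENSUS-DelsarteLasserre.md` (crux-strategist `cstrat-stmt-PneNP-2126-r1`, gen 1, 2026-08-17)

NOT TO BE CONFUSED with `Cruxes/Target/{STRATEGY-CENSUS.md, StrategyCensus.lean}`, which audit the OTHER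
crux named `Target` (stmt-PneNP-10709, route LatticeMagic, `∃ c ≥ 1, GapCVP_c ∉ PromiseCoNP`); the crux
directory `Cruxes/Target/` is shared by the two items because crux directories are keyed by the short decl name.

Crux `X := Summit.PneNP.PneNP.Theses.DelsarteLasserre.Target = L_code ∉ EXP` ("the code-size function
`A(n,d)` is not computable in time `2^{poly(n)}`"), `S := _root_.PneNP`. The re-audit (bin RESTATED) asks for a
typed decomposition `X₁ ∧ … ∧ X_k → X` with (a) every piece load-bearing, (b) a PROVED, NON-TRIVIAL assembly,
(c) no piece equivalent to / at least `X` or `S` — or a census of every attempt with the violated clause.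
This file holds what a kernel can check of that census. 0 `sorry`. Nothing here is a landing; it is EVIDENCE.
Every fact used is a PROVED theorem of the tree (the route's three support items, Book/Arora–Barak padding,
closure of `EXP`/`NEXP` under Karp reductions); the one unformalised standard fact (`bridge` in §D4, "an
`EXP` decider is a padded proof system") appears only as an explicit hypothesis of the statements that use it.

## §0 Where the crux stands
`X ↔ L_code ∉ EXP` (by `rfl`), `L_code ∈ NEXP` (support item, proved), `X → S` (the route's `closes` fed by the
three proved supports), `¬S → NEXP = EXP → L_code ∈ EXP`, `X → EXP ≠ NEXP`. So X sits AT OR ABOVE the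
summit, in the accepted picture strictly above (`NEXP ≠ EXP`-type; converse `S → X` unknown).

## §1 Audit lemmas (pure logic): `useless_piece`, `conditional_piece`, `bridge_piece`, the `X ∨ E` normal form.

## §D The attempts, typed, each with its assembly and the clause it violates
* D1 hardness ⊕ separation `(K ≤ₚ L_code) ∧ (K ∉ EXP)`: assembly = ONE line (closure of `EXP` under `≤ₚ`) — (b);
  the reduction piece forces `K ∈ NEXP`, whence the separation piece is `≥ S` — (c). Class form
  `NEXP-hard ∧ NEXP ≠ EXP`: `NEXP ≠ EXP → S` in one line — (c).
* D2 time axis `X ↔ ∀ k, L_code ∉ DTIME(2^{n^k})`: levels are antitone, a finite set of levels is its top level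
  (never `X`), every cofinal tail IS `X`; the speed-up bridge `(L_code ∈ EXP → level k)` recombines by modus
  ponens and is `X ∨ (L_code ∈ DTIME(2^{n^k}))` — (a)/(b). §D2′ (addendum): `L_code ∈ NE`, `¬S → L_code ∈ E`,
  so EVERY level `k ≥ 2` is `≥ S` — (c); only the linear-exponential pieces `L_code ∉ DTIME(2^{cn})` are not,
  and their conjunction `L_code ∉ E` is `≥ S` and still below `X`.
* D4 certificate-class completeness `FloorInexact ∧ (L_code ∈ EXP → ¬FloorInexact)`: modus tollens — (b); the
  bridge is `X ∨ ¬FloorInexact`. D4★ (the best typed split: Lasserre p-optimality on code-size upper bounds):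
  its load-bearing content is the global implication `ShortProofs → PolyLevelFloorExact`; modulo the
  piece-independent standard fact `bridge : L_code ∈ EXP → ShortProofs` the seam is again modus ponens — (b).
* D5 win–win along `NEXP = EXP`: one branch `≥ S` (`conditional_piece`), the other a consequence of `¬S`.
* D6 padding down: a piece `Lp ∉ P` with `Lp ∈ NP` is literally a witness of `S` — (c).
* D8 `L_code ∉ io-EXP`, D9 `L_code ∉ co NEXP`, `co NEXP ≠ NEXP`, `NEXP ≠ EXP`: bridges from above — (c).
-/

set_option linter.dupNamespace false
set_option linter.unusedVariables false

namespace Summit.PneNP.PneNP.Cruxes.DelsarteLasserreTarget.DecompositionAudit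

open Filter
open Literature.Computability.Complexity Literature.Computability.Complexity.Nondeterministic
open Summit.PneNP.PneNP.Theses.DelsarteLasserre
open Summit.PneNP.PneNP.Theorems
open _root_.Computability Literature.Computability.MetaComplexity

/-! ## §0 Read-back: the crux, its language, and its position relative to the summit -/

/-- The code-size language `L_code = {⟨1ⁿ,⟨1ᵈ,u⟩⟩ : bitsToNat u ≤ A(n,d)}`, verbatim the set in `Target`. [folklore] -/
def Lcode : Language Bool :=
  {w : List Bool | ∃ n d : ℕ, ∃ u : List Bool,
    w = boolPair (List.replicate n true) (boolPair (List.replicate d true) u) ∧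
      bitsToNat u ≤ (SimpleGraph.fromRel fun x y : Fin n → Bool => hammingDist x y < d).indepNum}

/-- `X ↔ L_code ∉ EXP` (definitional). [folklore] -/
theorem target_iff : Target ↔ Lcode ∉ EXP := Iff.rfl

/-- `L_code ∈ NEXP` — the route's PROVED support item `CodeSizeLangInNEXP` (stmt-PneNP-2130). [folklore] -/
theorem Lcode_mem_NEXP : Lcode ∈ NEXP := delsarteLasserre_codeSizeLangInNEXP_proof

/-- `S ↔ NP ⊄ P` in the tree's working classes (the route's PROVED support item `ClassBridges`). [folklore] -/
theorem pneNP_iff_not_NP_subset_P : _root_.PneNP ↔ ¬ (NP ⊆ Classes.P) := by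
  have h := ClassBridges_holds
  show Literature.PNP.PNeNP ↔ _
  unfold Literature.PNP.PNeNP
  rw [h.1, h.2, Set.not_subset]

/-- **`X → S`**, unconditional in the tree: the route's deciding theorem `closes` fed by its three PROVED
support items. This is why the crux is binned AT-LEAST-SUMMIT. [folklore] -/
theorem pneNP_of_target : Target → _root_.PneNP := fun hT =>
  closes hT delsarteLasserre_codeSizeLangInNEXP_proof delsarteLasserre_nexpSubsetExpOfNpSubsetP_proof
    ClassBridges_holds

/-- `¬S → NP ⊆ P`. [folklore] -/
theorem NP_subset_P_of_not_pneNP (h : ¬ _root_.PneNP) : NP ⊆ Classes.P := by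
  by_contra h'
  exact h (pneNP_iff_not_NP_subset_P.2 h')

/-- `¬S → NEXP ⊆ EXP` (upward padding, Book 1974 / Arora–Barak Thm. 2.22, PROVED in the tree). [folklore] -/
theorem NEXP_subset_EXP_of_not_pneNP (h : ¬ _root_.PneNP) : NEXP ⊆ EXP :=
  NEXP_subset_EXP_of_NP_subset_P (NP_subset_P_of_not_pneNP h)

/-- `¬S → NEXP = EXP`. [folklore] -/
theorem NEXP_eq_EXP_of_not_pneNP (h : ¬ _root_.PneNP) : NEXP = EXP :=
  Set.Subset.antisymm (NEXP_subset_EXP_of_not_pneNP h) EXP_subset_NEXP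

/-- `¬S → L_code ∈ EXP` (= `¬S → ¬X`, the contrapositive of `X → S`, with the witness level UNSPECIFIED). [folklore] -/
theorem Lcode_mem_EXP_of_not_pneNP (h : ¬ _root_.PneNP) : Lcode ∈ EXP :=
  NEXP_subset_EXP_of_not_pneNP h Lcode_mem_NEXP

/-- **`X → EXP ≠ NEXP`**: the crux is an `NEXP ≠ EXP`-type statement (one explicit `NEXP` language outside
`EXP`). The converse `EXP ≠ NEXP → X` would be `NEXP`-hardness of `L_code`, which nobody claims. [folklore] -/
theorem EXP_ne_NEXP_of_target (hT : Target) : EXP ≠ NEXP := fun hE =>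
  hT (show Lcode ∈ EXP by rw [hE]; exact Lcode_mem_NEXP)

/-! ## §1 The audit lemmas (pure logic) -/

/-- **USELESS-PIECE LEMMA.** A piece implied by `¬S` carries none of the `S`-content of an assembly. [folklore] -/
theorem useless_piece {S A B : Prop} (hA : ¬ S → A) (h : A → B → S) : B → S :=
  fun hB => Classical.byContradiction fun hS => hS (h (hA hS) hB)

/-- **CONDITIONAL-PIECE LEMMA.** With `X → S` proved, a piece `A → X` whose antecedent follows from `¬S` is
itself `≥ S`. [folklore] -/
theorem conditional_piece {S X A : Prop} (hXS : X → S) (hA : ¬ S → A) : (A → X) → S :=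
  fun h => Classical.byContradiction fun hS => hS (hXS (h (hA hS)))

/-- **BRIDGE LEMMA.** A piece with a PROVED arrow to `X` is `≥ S`. [folklore] -/
theorem bridge_piece {S X H : Prop} (hXS : X → S) (hb : H → X) : H → S :=
  fun h => hXS (hb h)

/-- **Pieces below `X` are `X ∨ E`**; two of them recombine to `X` iff their `E`-parts are jointly
inconsistent with `¬X`, and the seam is exactly as deep as that inconsistency proof. [folklore] -/
theorem below_X_normal_form {X A : Prop} (h : X → A) : A ↔ (X ∨ (¬ X ∧ A)) := by
  tauto

/-- The recombination criterion for two `X ∨ Eᵢ` pieces. [folklore] -/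
theorem recombine_iff {X E₁ E₂ : Prop} : ((X ∨ E₁) → (X ∨ E₂) → X) ↔ (¬ X → ¬ (E₁ ∧ E₂)) := by
  tauto

/-! ## §D1 Hardness ⊕ separation: `(K ≤ₚ L_code) ∧ (K ∉ EXP) → X` -/

/-- **D1 assembly** — ONE line, the closure of `EXP` under Karp reductions: a trivial seam, clause (b). [folklore] -/
theorem D1_assembly (K : Language Bool) (hred : PolyTimeKarpReducible K Lcode) (hsep : K ∉ EXP) : Target :=
  fun hL => hsep (mem_EXP_of_karpReducible hred hL)

/-- The reduction piece FORCES `K ∈ NEXP` (closure of `NEXP` under `≤ₚ`, proved in the tree). [folklore] -/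
theorem D1_reduction_forces_NEXP (K : Language Bool) (hred : PolyTimeKarpReducible K Lcode) : K ∈ NEXP :=
  mem_NEXP_of_karpReducible hred Lcode_mem_NEXP

/-- **The separation piece is `≥ S`** as soon as `K ∈ NEXP` is known (every natural candidate: succinct SAT,
succinct clique, any padded `NE`-complete set …) — clause (c). [folklore] -/
theorem D1_separation_piece_ge_S (K : Language Bool) (hK : K ∈ NEXP) : K ∉ EXP → _root_.PneNP :=
  fun hsep => Classical.byContradiction fun hS => hsep (NEXP_subset_EXP_of_not_pneNP hS hK)

/-- … and WITHIN the split it is `≥ S` unconditionally: the other piece supplies `K ∈ NEXP`. So either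
`K ∈ NEXP` is known and the separation piece alone is `≥ S`, or it is not and then the reduction piece is the
only evidence that `K ∈ NEXP` at all (no such `K` is on record). [folklore] -/
theorem D1_separation_piece_ge_S_within (K : Language Bool) (hred : PolyTimeKarpReducible K Lcode) :
    K ∉ EXP → _root_.PneNP :=
  D1_separation_piece_ge_S K (D1_reduction_forces_NEXP K hred)

/-- **D1, class form.** `NEXP`-hardness of `L_code` ∧ `NEXP ≠ EXP` → `X` (two lines of closure) … [folklore] -/
theorem D1_class_assembly (hhard : ∀ K ∈ NEXP, PolyTimeKarpReducible K Lcode) (hsep : NEXP ≠ EXP) : Target :=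
  fun hL => hsep (Set.Subset.antisymm (fun K hK => mem_EXP_of_karpReducible (hhard K hK) hL) EXP_subset_NEXP)

/-- … whose separation piece `NEXP ≠ EXP` is `≥ S` in one line (Arora–Barak Thm. 2.22, proved) — clause (c). [folklore] -/
theorem D1_class_separation_ge_S : NEXP ≠ EXP → _root_.PneNP :=
  fun h => Classical.byContradiction fun hS => h (NEXP_eq_EXP_of_not_pneNP hS)

/-! ## §D2 The time axis: `X ↔ ∀ k, L_code ∉ DTIME(2^{n^k})` -/

/-- The level-`k` piece `X_k := L_code ∉ DTIME(2^{n^k})`. [folklore] -/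
def Level (k : ℕ) : Prop := Lcode ∉ DTIME (fun n => 2 ^ (n ^ k))

/-- `X` is the conjunction of all levels (definitional: `EXP = ⋃ₖ DTIME(2^{n^k})`). [folklore] -/
theorem target_iff_forall_level : Target ↔ ∀ k, Level k := by
  rw [target_iff]
  show (Lcode ∉ ⋃ k : ℕ, DTIME fun n => 2 ^ (n ^ k)) ↔ ∀ k, Lcode ∉ DTIME fun n => 2 ^ (n ^ k)
  simp only [Set.mem_iUnion, not_exists]

/-- `DTIME(2^{n^k}) ⊆ DTIME(2^{n^{k'}})` for `k ≤ k'` (the `+c` slack of `DTIME` absorbs `n = 0`). [folklore] -/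
theorem DTIME_level_mono {k k' : ℕ} (hkk' : k ≤ k') :
    DTIME (fun n => 2 ^ (n ^ k)) ⊆ DTIME (fun n => 2 ^ (n ^ k')) := by
  rintro L ⟨c, hc⟩
  refine ⟨2 * c, timeClass_mono (fun n => ?_) hc⟩
  show c * 2 ^ (n ^ k) + c ≤ 2 * c * 2 ^ (n ^ k') + 2 * c
  rcases Nat.eq_zero_or_pos n with rfl | hn
  · have h1 : 2 ^ (0 ^ k) ≤ 2 := by
      cases k with
      | zero => simp
      | succ k => simp
    have h2 : 1 ≤ 2 ^ (0 ^ k') := Nat.one_le_two_pow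
    nlinarith
  · have h3 : 2 ^ (n ^ k) ≤ 2 ^ (n ^ k') :=
      Nat.pow_le_pow_right Nat.two_pos (Nat.pow_le_pow_right hn hkk')
    have h4 : c * 2 ^ (n ^ k) + c ≤ c * 2 ^ (n ^ k') + c := by gcongr
    calc c * 2 ^ (n ^ k) + c ≤ c * 2 ^ (n ^ k') + c := h4
      _ ≤ (c * 2 ^ (n ^ k') + c) + (c * 2 ^ (n ^ k') + c) := Nat.le_add_right _ _
      _ = 2 * c * 2 ^ (n ^ k') + 2 * c := by ring

/-- Levels are ANTITONE: a higher level implies every lower one. [folklore] -/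
theorem level_antitone {k k' : ℕ} (h : k ≤ k') : Level k' → Level k :=
  fun h' hL => h' (DTIME_level_mono h hL)

/-- **A finite set of levels is its top level** — so no finite sub-conjunction of levels is more than ONE
level, and one level is not `X` (clause (a)/(b): the pieces strictly below both `X` and `S` on this axis never
assemble to `X` in finitely many). [folklore] -/
theorem finite_levels_iff_top (s : Finset ℕ) : (∀ k ∈ s, Level k) ↔ (s = ∅ ∨ Level (s.sup id)) := by
  constructor
  · intro h
    rcases s.eq_empty_or_nonempty with hs | hs
    · exact Or.inl hs
    · obtain ⟨k, hk, hk'⟩ := Finset.exists_mem_eq_sup s hs id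
      exact Or.inr (hk' ▸ h k hk)
  · rintro (rfl | h) k hk
    · exact absurd hk (Finset.notMem_empty k)
    · exact level_antitone (Finset.le_sup (f := id) hk) h

/-- **Every cofinal tail of levels IS `X`** (clause (c): a piece containing infinitely many levels is the
crux reworded). [folklore] -/
theorem tail_iff_target (k₀ : ℕ) : (∀ k, k₀ ≤ k → Level k) ↔ Target := by
  rw [target_iff_forall_level]
  exact ⟨fun h k => (le_total k₀ k).elim (h k) fun hk => level_antitone hk (h k₀ le_rfl), fun h k _ => h k⟩

/-- Under `¬S` the language sits at SOME level, with no bound on which (the exponent is inherited from the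
hypothetical polynomial-time `SAT` algorithm): this is why no SINGLE level `X_k` is `≥ S` by anything in the
tree, and also why no single level can be refuted. [folklore] -/
theorem exists_not_level_of_not_pneNP (h : ¬ _root_.PneNP) : ∃ k, ¬ Level k := by
  have hE := Lcode_mem_EXP_of_not_pneNP h
  simp only [EXP, Set.mem_iUnion] at hE
  obtain ⟨k, hk⟩ := hE
  exact ⟨k, fun h' => h' hk⟩

/-- The speed-up bridge `B_k := (L_code ∈ EXP → L_code ∈ DTIME(2^{n^k}))`. [folklore] -/
def SpeedUp (k : ℕ) : Prop := Lcode ∈ EXP → Lcode ∈ DTIME (fun n => 2 ^ (n ^ k))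

/-- `X_k ∧ B_k → X`: modus ponens — clause (b). [folklore] -/
theorem D2_bridge_assembly (k : ℕ) (hX : Level k) (hB : SpeedUp k) : Target :=
  fun hL => hX (hB hL)

/-- … and `B_k` is `X ∨ (L_code ∈ DTIME(2^{n^k}))`: the `X ∨ E` shape of §1 with `E₁ ∧ E₂ = Level k ∧ ¬Level k`. [folklore] -/
theorem speedUp_iff (k : ℕ) : SpeedUp k ↔ (Target ∨ Lcode ∈ DTIME (fun n => 2 ^ (n ^ k))) := by
  unfold SpeedUp
  rw [target_iff]
  tauto

/-! ## §D4 Certificate-class completeness (the route's own vocabulary: the Lasserre hierarchy on `H(n,d)`) -/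

/-- `F` := floor-form polynomial-level Lasserre inexactness — VERBATIM the signature of the route's rev-1 crux
`PolyLevelLasserreInexact` (stmt-PneNP-2127, superseded by the margin form, not refuted): for every polynomial
`p`, infinitely often some `d` has a level-`p(n)` feasible pseudo-moment vector of value `≥ A(n,d) + 1`.
[cite: Laurent2006, (22) and p. 248] -/
def FloorInexact : Prop :=
  ∀ p : Polynomial ℕ, ∃ᶠ n : ℕ in Filter.atTop, ∃ d : ℕ, ∃ y : Finset (Fin n → Bool) → ℝ, y ∅ = 1 ∧
    (∀ S, 0 ≤ y S) ∧ (∀ u v : Fin n → Bool, u ≠ v → hammingDist u v < d → y {u, v} = 0) ∧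
    (Matrix.of fun I J : {S : Finset (Fin n → Bool) // S.card ≤ p.eval n} => y (I.1 ∪ J.1)).PosSemidef ∧
    ((SimpleGraph.fromRel fun u v : Fin n → Bool => hammingDist u v < d).indepNum : ℝ) + 1 ≤
      ∑ v : Fin n → Bool, y {v}

/-- The completeness bridge as the route states it informally, REVERSED ("an `EXP` algorithm for `A(n,d)` would
make some polynomial level floor-exact"): `C := L_code ∈ EXP → ¬F`. [folklore] -/
def AlgToSOS : Prop := Lcode ∈ EXP → ¬ FloorInexact

/-- **D4 assembly `F ∧ C → X`**: modus tollens — clause (b). [folklore] -/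
theorem D4_assembly (hF : FloorInexact) (hC : AlgToSOS) : Target :=
  fun hL => hC hL hF

/-- `C` is `X ∨ ¬F` on the nose. [folklore] -/
theorem algToSOS_iff : AlgToSOS ↔ (Target ∨ ¬ FloorInexact) := by
  unfold AlgToSOS
  rw [target_iff]
  tauto

/-- `C` passes clause (c) only vacuously: under `¬S` it IS `¬F` (an open SOS statement), so no tree theorem
makes it `≥ S`; its whole `S`-content is the disjunct `X`. [folklore] -/
theorem algToSOS_iff_of_not_pneNP (h : ¬ _root_.PneNP) : AlgToSOS ↔ ¬ FloorInexact :=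
  ⟨fun hC => hC (Lcode_mem_EXP_of_not_pneNP h), fun hn _ => hn⟩

/-! ### D4★ — the best typed split found: Lasserre p-optimality on code-size UPPER bounds -/

/-- The language of valid code-size UPPER bounds `UB_code = {⟨1ⁿ,⟨1ᵈ,u⟩⟩ : A(n,d) < bitsToNat u}`
(the well-formed part of the complement of `L_code`). [folklore] -/
def UBcode : Language Bool :=
  {w : List Bool | ∃ n d : ℕ, ∃ u : List Bool,
    w = boolPair (List.replicate n true) (boolPair (List.replicate d true) u) ∧
      (SimpleGraph.fromRel fun x y : Fin n → Bool => hammingDist x y < d).indepNum < bitsToNat u}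

/-- "Level `t` of the Lasserre/Laurent hierarchy floor-certifies `A(n,d) < M`": every level-`t` feasible
pseudo-moment vector has value `< M` (the inline hierarchy of the route, edge constraints plus nonnegativity).
[cite: Laurent2006, (22)] -/
def LasserreCertifies (t n d M : ℕ) : Prop :=
  ∀ y : Finset (Fin n → Bool) → ℝ, y ∅ = 1 → (∀ S, 0 ≤ y S) →
    (∀ u v : Fin n → Bool, u ≠ v → hammingDist u v < d → y {u, v} = 0) →
    (Matrix.of fun I J : {S : Finset (Fin n → Bool) // S.card ≤ t} => y (I.1 ∪ J.1)).PosSemidef →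
    ∑ v : Fin n → Bool, y {v} < (M : ℝ)

/-- **M★ (piece 2 of D4★): polynomial-level Lasserre p-simulates EVERY Cook–Reckhow proof system for `UB_code`
at exponential scale** — for every proof system `V` and every `q'` there is `q` such that each upper bound
`A(n,d) < M` with a `V`-proof of size `≤ 2^{q'(n)}` is floor-certified at level `q(n)`. (Per-instance; the
`S`-carrying piece of the split; no analogue is known to hold — Grigoriev's degree lower bounds for knapsack /
Tseitin are the false analogues for integrality-type arguments.) [cite: CookReckhow1979, §1] [cite: Laurent2006, (22)] -/
def LasserreOptimal : Prop :=
  ∀ V : List Bool → List Bool → Bool, IsProofSystemFor V UBcode → ∀ q' : Polynomial ℕ, ∃ q : Polynomial ℕ,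
    ∀ n d : ℕ, ∀ u π : List Bool,
      V (boolPair (List.replicate n true) (boolPair (List.replicate d true) u)) π = true →
      π.length ≤ 2 ^ (q'.eval n) → LasserreCertifies (q.eval n) n d (bitsToNat u)

/-- "`UB_code` has a proof system with proofs of size `2^{poly(n)}` for EVERY valid upper bound"
(at exponential scale: `L_code ∈ co-NEXP`-type). [cite: CookReckhow1979, §1] -/
def ShortProofs : Prop :=
  ∃ V : List Bool → List Bool → Bool, IsProofSystemFor V UBcode ∧ ∃ q' : Polynomial ℕ,
    ∀ n d : ℕ, ∀ u : List Bool,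
      boolPair (List.replicate n true) (boolPair (List.replicate d true) u) ∈ UBcode →
      ∃ π : List Bool, π.length ≤ 2 ^ (q'.eval n) ∧
        V (boolPair (List.replicate n true) (boolPair (List.replicate d true) u)) π = true

/-- "Some polynomial level is floor-exact EVERYWHERE" (= `¬F` strengthened from eventually/somewhere to all
`(n,d)`; it implies `¬F`). [cite: Laurent2006, (22)] -/
def PolyLevelFloorExact : Prop :=
  ∃ q : Polynomial ℕ, ∀ n d M : ℕ,
    (SimpleGraph.fromRel fun x y : Fin n → Bool => hammingDist x y < d).indepNum < M →
    LasserreCertifies (q.eval n) n d M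

/-- Floor-exactness at one polynomial level everywhere refutes `F`. [folklore] -/
theorem not_floorInexact_of_polyLevelFloorExact (h : PolyLevelFloorExact) : ¬ FloorInexact := by
  rintro hF
  obtain ⟨q, hq⟩ := h
  obtain ⟨n, d, y, hy0, hy1, hy2, hy3, hy4⟩ := (hF q).exists
  have hlt := hq n d ((SimpleGraph.fromRel fun x y : Fin n → Bool => hammingDist x y < d).indepNum + 1)
    (Nat.lt_succ_self _) y hy0 hy1 hy2 hy3
  push_cast at hlt
  linarith

/-- **The load-bearing content of M★ is GLOBAL**: short proofs everywhere ⟹ one polynomial level floor-exact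
everywhere. (The per-instance surplus of M★ is never used by the assembly below.) [folklore] -/
theorem polyLevelFloorExact_of_lasserreOptimal (hM : LasserreOptimal) (hS : ShortProofs) :
    PolyLevelFloorExact := by
  obtain ⟨V, hV, q', hsp⟩ := hS
  obtain ⟨q, hq⟩ := hM V hV q'
  refine ⟨q, fun n d M hM' => ?_⟩
  have hmem : boolPair (List.replicate n true) (boolPair (List.replicate d true) (encodeNat M)) ∈ UBcode :=
    ⟨n, d, encodeNat M, rfl, by rwa [bitsToNat_encodeNat]⟩
  obtain ⟨π, hπ, hVπ⟩ := hsp n d (encodeNat M) hmem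
  simpa only [bitsToNat_encodeNat] using hq n d (encodeNat M) π hVπ hπ

/-- The global form of M★ that the assembly actually consumes. [folklore] -/
def LasserreOptimalGlobal : Prop := ShortProofs → PolyLevelFloorExact

/-- M★ ⟹ its global form. [folklore] -/
theorem lasserreOptimalGlobal_of_lasserreOptimal (hM : LasserreOptimal) : LasserreOptimalGlobal :=
  polyLevelFloorExact_of_lasserreOptimal hM

/-- **D4★ assembly skeleton.** Modulo the piece-INDEPENDENT standard fact
`bridge : L_code ∈ EXP → ShortProofs` ("a `2^{m^k}`-time decider of `L_code` — hence of `UB_code`, by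
complement and format — is a proof system whose proofs are pads `1^{2^{m^k}}`"; true and routine, NOT
formalised: the tree has the translation only upward, `mem_EXP_of_padLang_mem_P`), the seam between the two
pieces is `hF ∘ hM ∘ bridge`: modus ponens. Quoting it is the (b)-verdict. [folklore] -/
theorem D4star_assembly_skeleton (bridge : Lcode ∈ EXP → ShortProofs) (hM : LasserreOptimalGlobal)
    (hF : FloorInexact) : Target :=
  fun hL => not_floorInexact_of_polyLevelFloorExact (hM (bridge hL)) hF

/-- The same with the per-instance M★. [folklore] -/
theorem D4star_assembly_skeleton' (bridge : Lcode ∈ EXP → ShortProofs) (hM : LasserreOptimal)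
    (hF : FloorInexact) : Target :=
  D4star_assembly_skeleton bridge (lasserreOptimalGlobal_of_lasserreOptimal hM) hF

/-- The `X ∨ E` shape of the consumed piece: `LasserreOptimalGlobal ↔ ¬ShortProofs ∨ PolyLevelFloorExact`,
where (given `bridge`) `¬ShortProofs` is a bridge-from-above piece `≥ X ≥ S` and `PolyLevelFloorExact` is
`¬F`-type. [folklore] -/
theorem lasserreOptimalGlobal_iff : LasserreOptimalGlobal ↔ (¬ ShortProofs ∨ PolyLevelFloorExact) := by
  unfold LasserreOptimalGlobal
  tauto

/-- Given `bridge`, "no short proofs of code-size upper bounds" is `≥ X` (hence `≥ S`). [folklore] -/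
theorem noShortProofs_ge_target (bridge : Lcode ∈ EXP → ShortProofs) : ¬ ShortProofs → Target :=
  fun h hL => h (bridge hL)

/-! ## §D5 Win–win along a dichotomy `H`: `(H → X) ∧ (¬H → X) → X` -/

/-- **D5 assembly**: excluded middle — clause (b). [folklore] -/
theorem D5_assembly (H : Prop) (h₁ : H → Target) (h₂ : ¬ H → Target) : Target :=
  (Classical.em H).elim h₁ h₂

/-- Along `H := (NEXP = EXP)`: the branch `H → X` is `≥ S` (`conditional_piece`, since `¬S → H`) … [folklore] -/
theorem D5_branch₁_ge_S : ((NEXP = EXP) → Target) → _root_.PneNP :=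
  conditional_piece pneNP_of_target NEXP_eq_EXP_of_not_pneNP

/-- … and the branch `¬H → X` ("`L_code` is among the witnesses of `NEXP ≠ EXP`") is a CONSEQUENCE of `¬S`
(vacuously), i.e. a useless piece. The same two verdicts hold for every `H` decided by `¬S`. [folklore] -/
theorem D5_branch₂_of_not_pneNP (h : ¬ _root_.PneNP) : (NEXP ≠ EXP) → Target :=
  fun hne => absurd (NEXP_eq_EXP_of_not_pneNP h) hne

/-! ## §D6 Padding down: pieces `Lp ∉ P` for padded versions `Lp ∈ NP` of `L_code` -/

/-- **Any piece of the shape `Lp ∉ P` with `Lp ∈ NP` proved is literally a witness of `S`** — clause (c).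
(Each padded-down slice `pad_k(L_code)` is in `NP` for `k ≥ 2`; `X → pad_k(L_code) ∉ P` for every `k` by
`mem_EXP_of_padLang_mem_P`; so the padded pieces are consequences of `X`, each `≥ S`, and `X` is again their
infinite conjunction as in §D2.) [folklore] -/
theorem D6_padded_piece_ge_S {Lp : Language Bool} (hLp : Lp ∈ NP) : Lp ∉ Classes.P → _root_.PneNP :=
  fun h => pneNP_iff_not_NP_subset_P.2 fun hsub => h (hsub hLp)

/-- `X → pad_k(L_code) ∉ P` for every `k ≥ 1` (upward translation, proved in the tree). [folklore] -/
theorem padLang_not_mem_P_of_target (hT : Target) {k : ℕ} (hk : 1 ≤ k) : padLang k Lcode ∉ Classes.P :=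
  fun h => hT (mem_EXP_of_padLang_mem_P hk h)

/-! ## §D8 Infinitely-often / average-case strengthenings: bridges from above -/

/-- `C ⊆ io-C`. [folklore] -/
theorem subset_io' (C : Set (Language Bool)) : C ⊆ io C := fun L hL =>
  ⟨L, hL, Filter.Frequently.of_forall fun _ _ _ => Iff.rfl⟩

/-- `L_code ∉ io-EXP → X` (almost-everywhere hardness is a bridge from above) … [folklore] -/
theorem D8_io_piece_ge_target : Lcode ∉ io EXP → Target :=
  fun h hL => h (subset_io' EXP hL)

/-- … hence `≥ S` — clause (c). [folklore] -/
theorem D8_io_piece_ge_S : Lcode ∉ io EXP → _root_.PneNP :=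
  bridge_piece pneNP_of_target D8_io_piece_ge_target

/-! ## §D9 Other bridges from above -/

/-- `L_code ∉ co-NEXP → X` (`EXP = co-EXP ⊆ co-NEXP`) — `≥ X ≥ S`, clause (c). [folklore] -/
theorem D9_coNEXP_piece_ge_target : Lcode ∉ co NEXP → Target :=
  fun h hL => h (show Lcodeᶜ ∈ NEXP from EXP_subset_NEXP (compl_mem_EXP_iff.2 hL))

/-- `co NEXP ≠ NEXP → S` (via `EXP ≠ NEXP`, proved in the tree) — a candidate "proof-complexity" piece that is
`≥ S` on its own, clause (c); it does not even imply `X` (no hardness of `L_code`). [folklore] -/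
theorem D9_coNEXP_ne_NEXP_ge_S : co NEXP ≠ NEXP → _root_.PneNP :=
  fun h => D1_class_separation_ge_S fun h' => EXP_ne_NEXP_of_co_NEXP_ne_NEXP h h'.symm

/-! ## §D2′ (addendum, session 5) — the level threshold: every level `X_k`, `k ≥ 2`, is `≥ S`

Correction of §D2's "no single level is `≥ S`". `L_code` has LINEAR-exponential certificates: a code of
`K ≤ 2ⁿ` words of `n` bits, `K(n+1) ≤ 4ⁿ ≤ 2^{|x|}`, checked in time polynomial in its length (the route's own
typed test `delsarteLasserre_exists_codeTest`). Hence `L_code` is the preimage of an `NP` language under the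
`2^{O(n)}`-time pad `lpad 1` — so `L_code ∈ NE` — and under `¬S` that `NP` language is in `P`, whence
`L_code ∈ E ⊆ DTIME(2^{n²})` (no Book translation needed: `preimage_mem_E`). So `¬S → ¬X_2`, i.e. EVERY level
`X_k` with `k ≥ 2` is `≥ S` (clause (c)), and the only time-axis pieces not known to be `≥ S` are the
linear-exponential ones `L_code ∉ DTIME(2^{c·n})`, `c` fixed, whose conjunction over all `c` is `L_code ∉ E` —
itself `≥ S` and still strictly BELOW `X`. The time axis therefore offers no piece that is both `< S` and within
finite conjunctive reach of `X`.
-/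

section LevelThreshold

open Literature.Computability.Complexity.CodeFP Literature.Computability.Complexity.Brick Polynomial

/-- **The certificates of `L_code`, re-packaged** (verbatim the completeness/soundness halves of the route's
`delsarteLasserre_codeSizeLangInNEXP_proof`, with the relation `R ∈ P` exposed): witnesses of length
`≤ 2^{|x|} + 1`. [cite: AroraBarak2009, §2.6.2] [folklore] -/
theorem exists_code_certificates :
    ∃ R : Language Bool, R ∈ Classes.P ∧
      (∀ x ∈ Lcode, ∃ y : List Bool, y.length ≤ 1 * 2 ^ (x.length ^ 1) + 1 ∧ boolPair x y ∈ R) ∧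
      (∀ x y : List Bool, boolPair x y ∈ R → x ∈ Lcode) := by
  classical
  obtain ⟨τ, ⟨g, hg, hgspec⟩, hspec⟩ := delsarteLasserre_exists_codeTest
  set R : Language Bool := g ⁻¹' PRelSigma.HeadIs true with hR
  have hRP : R ∈ Classes.P := preimage_mem_P (PRelSigma.HeadIs_mem_P true) hg
  have hRsem : ∀ z : List Bool, z ∈ R ↔ τ z = true := by
    intro z
    change g z ∈ PRelSigma.HeadIs true ↔ _
    rw [PRelSigma.mem_HeadIs, show g z = g (strE z) from rfl, hgspec z]
    simp [bitE]
  refine ⟨R, hRP, ?_, ?_⟩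
  · -- completeness: list `K` words of a maximum independent set
    intro x hx
    obtain ⟨n, d, u, rfl, hK⟩ := hx
    set G : SimpleGraph (Fin n → Bool) := SimpleGraph.fromRel fun x y : Fin n → Bool => hammingDist x y < d with hG
    set K := bitsToNat u with hKdef
    obtain ⟨s, hs⟩ := G.exists_isNIndepSet_indepNum
    obtain ⟨t, hts, htK⟩ := Finset.exists_subset_card_eq (show K ≤ s.card by rw [hs.card_eq]; exact hK)
    have hlen : t.toList.length = K := by rw [Finset.length_toList, htK]
    have hnd : t.toList.Nodup := Finset.nodup_toList t
    refine ⟨((t.toList.map fun w => List.ofFn w).flatten) ++ List.replicate K true, ?_, ?_⟩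
    · -- length `K(n+1) ≤ 4ⁿ ≤ 2^{|x|}`
      rw [List.length_append, delsarteLasserre_length_flatten, hlen, List.length_replicate, pow_one, one_mul,
        length_boolPair, List.length_replicate]
      have hK2 : K ≤ 2 ^ n := by
        rw [← htK]
        have h := Finset.card_le_univ t
        rwa [Fintype.card_fun, Fintype.card_bool, Fintype.card_fin] at h
      have hn : n + 1 ≤ 2 ^ n := Nat.lt_two_pow_self
      calc K * n + K = K * (n + 1) := by ring
        _ ≤ 2 ^ n * 2 ^ n := Nat.mul_le_mul hK2 hn
        _ = 2 ^ (2 * n) := by rw [← pow_add, two_mul]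
        _ ≤ 2 ^ (2 * n + 2 + (boolPair (List.replicate d true) u).length) := Nat.pow_le_pow_right (by norm_num) (by omega)
        _ ≤ _ := Nat.le_succ _
    · rw [hRsem, hspec]
      simp only [fstF_boolPair, sndF_boolPair, List.length_replicate, List.length_append, delsarteLasserre_length_flatten,
        hlen]
      refine ⟨trivial, trivial, trivial, trivial, by omega, by nlinarith, fun i hi j hj hij => ?_⟩
      rw [← hKdef] at hi hj
      rw [delsarteLasserre_block_flatten _ _ i (by omega), delsarteLasserre_block_flatten _ _ j (by omega),
        delsarteLasserre_count_eq_hammingDist, delsarteLasserre_read_ofFn, delsarteLasserre_read_ofFn]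
      have hne : t.toList[i]'(by omega) ≠ t.toList[j]'(by omega) := by
        rw [Ne, hnd.getElem_inj_iff]
        exact hij.ne
      refine ⟨fun h => hne (List.ofFn_injective h), ?_⟩
      have hi' : t.toList[i]'(by omega) ∈ s := hts (Finset.mem_toList.1 (List.getElem_mem _))
      have hj' : t.toList[j]'(by omega) ∈ s := hts (Finset.mem_toList.1 (List.getElem_mem _))
      have hadj := hs.isIndepSet hi' hj' hne
      rw [hG, SimpleGraph.fromRel_adj] at hadj
      exact not_lt.1 fun hlt => hadj ⟨hne, Or.inl hlt⟩
  · -- soundness: the blocks form an independent `K`-set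
    intro x y hxy
    rw [hRsem, hspec] at hxy
    obtain ⟨h1, h2, h3, h4, h5, h6, h7⟩ := hxy
    refine ⟨(fstF x).length, (fstF (sndF x)).length, sndF (sndF x), ?_, ?_⟩
    · conv_lhs => rw [← h1, ← h2]
      rw [← h3, ← h4]
    · set n := (fstF x).length with hn
      set d := (fstF (sndF x)).length with hd
      set K := bitsToNat (sndF (sndF x)) with hK
      set G : SimpleGraph (Fin n → Bool) := SimpleGraph.fromRel fun x y : Fin n → Bool => hammingDist x y < d with hG
      let w : ℕ → (Fin n → Bool) := fun i l => ((y.drop (i * n)).take n).getD l false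
      -- blocks have length `n`
      have hblen : ∀ i, i < K → ((y.drop (i * n)).take n).length = n := by
        intro i hi
        rw [List.length_take, List.length_drop]
        have : (i + 1) * n ≤ K * n := Nat.mul_le_mul_right n hi
        rw [Nat.succ_mul] at this
        have h6' : n * K ≤ y.length := h6
        rw [mul_comm] at h6'
        omega
      -- distinct blocks, read as words, are distinct
      have hwne : ∀ i, i < K → ∀ j, j < K → i < j → w i ≠ w j := by
        intro i hi j hj hij heq
        apply (h7 i hi j hj hij).1
        refine List.ext_getElem (by rw [hblen i hi, hblen j hj]) fun l hl₁ hl₂ => ?_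
        have hl : l < n := by rw [hblen i hi] at hl₁; exact hl₁
        have := congrFun heq ⟨l, hl⟩
        simp only [w] at this
        rwa [List.getD_eq_getElem _ _ hl₁, List.getD_eq_getElem _ _ hl₂] at this
      have hinj : Set.InjOn w ↑(Finset.range K) := by
        intro i hi j hj heq
        rw [Finset.coe_range, Set.mem_Iio] at hi hj
        by_contra hne
        rcases lt_or_gt_of_ne hne with h | h
        · exact hwne i hi j hj h heq
        · exact hwne j hj i hi h heq.symm
      have hind : G.IsIndepSet ↑((Finset.range K).image w) := by
        intro a ha b hb hab
        rw [Finset.coe_image, Finset.coe_range] at ha hb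
        obtain ⟨i, hi, rfl⟩ := ha
        obtain ⟨j, hj, rfl⟩ := hb
        rw [Set.mem_Iio] at hi hj
        rw [hG, SimpleGraph.fromRel_adj, not_and_or]
        right
        rw [not_or, not_lt, not_lt]
        have hne : i ≠ j := fun h => hab (h ▸ rfl)
        rcases lt_or_gt_of_ne hne with h | h
        · have hle := (h7 i hi j hj h).2
          rw [delsarteLasserre_count_eq_hammingDist] at hle
          exact ⟨hle, by rwa [hammingDist_comm]⟩
        · have hle := (h7 j hj i hi h).2
          rw [delsarteLasserre_count_eq_hammingDist] at hle
          exact ⟨by rwa [hammingDist_comm], hle⟩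
      calc K = ((Finset.range K).image w).card := by rw [Finset.card_image_of_injOn hinj, Finset.card_range]
        _ ≤ G.indepNum := hind.card_le_indepNum

/-- **`L_code` is the `lpad 1`-preimage of an `NP` language** (the pads `⟨1^{2^{|x|}} 0 1^{|x|}, x⟩` of its
members, with the code as polynomial-size witness; translation by padding, Arora–Barak 2009, §2.6.2).
[cite: AroraBarak2009, §2.6.2 (Thm. 2.22)] [folklore] -/
theorem exists_NP_pad : ∃ Lp : Language Bool, Lp ∈ NP ∧ Lcode = (lpad 1 ⁻¹' Lp : Language Bool) := by
  obtain ⟨R, hRP, hcomp, hsound⟩ := exists_code_certificates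
  have hh : fanoutFn (sndF ∘ fstF) sndF ∈ FP :=
    fanoutFn_mem_FP (comp_mem_FP sndF_mem_FP fstF_mem_FP) sndF_mem_FP
  have hval : ∀ x y : List Bool, fanoutFn (sndF ∘ fstF) sndF (boolPair (lpad 1 x) y) = boolPair x y := by
    intro x y
    simp only [fanoutFn_apply, Function.comp_apply, fstF_boolPair, sndF_boolPair, lpad]
  refine ⟨{z : List Bool | ∃ y : List Bool, y.length ≤ (X : Polynomial ℕ).eval z.length ∧
      boolPair z y ∈ (fanoutFn (sndF ∘ fstF) sndF ⁻¹' R : Language Bool)}, ?_, ?_⟩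
  · exact ⟨fanoutFn (sndF ∘ fstF) sndF ⁻¹' R, preimage_mem_P hRP hh, X, fun z => Iff.rfl⟩
  · ext x
    change x ∈ Lcode ↔ ∃ y : List Bool, y.length ≤ (X : Polynomial ℕ).eval (lpad 1 x).length ∧
      fanoutFn (sndF ∘ fstF) sndF (boolPair (lpad 1 x) y) ∈ R
    constructor
    · intro hx
      obtain ⟨y, hy, hyR⟩ := hcomp x hx
      refine ⟨y, ?_, by rwa [hval]⟩
      rw [eval_X, length_lpad]
      simp only [pow_one, one_mul] at hy ⊢
      omega
    · rintro ⟨y, -, hyR⟩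
      rw [hval] at hyR
      exact hsound x y hyR

/-- **`L_code ∈ NE`** (one certificate level sharper than the route's support item `CodeSizeLangInNEXP`).
[cite: Book1974, Lemma 3 (p. 188)] [folklore] -/
theorem Lcode_mem_NE : Lcode ∈ NE := by
  obtain ⟨Lp, hLp, hL⟩ := exists_NP_pad
  rw [hL]
  exact preimage_mem_NE_of_mem_FE hLp (lpad_mem_FE 1)

/-- **`¬S → L_code ∈ E`** — the level is now PINNED (contrast `Lcode_mem_EXP_of_not_pneNP`): under `NP ⊆ P`
the `NP` pad language is in `P` and its `lpad 1`-preimage is in `E`. [cite: AroraBarak2009, §2.6.2 (Thm. 2.22)] [folklore] -/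
theorem Lcode_mem_E_of_not_pneNP (h : ¬ _root_.PneNP) : Lcode ∈ E := by
  obtain ⟨Lp, hLp, hL⟩ := exists_NP_pad
  rw [hL]
  exact preimage_mem_E (lpad_mem_FE 1) (NP_subset_P_of_not_pneNP h hLp)

/-- `E ⊆ DTIME(2^{n²})` (`K·2^{cn} + K ≤ K'·2^{n²} + K'`). [folklore] -/
theorem E_subset_DTIME_sq : E ⊆ DTIME (fun n => 2 ^ (n ^ 2)) := by
  intro L hL
  rw [E, Set.mem_iUnion] at hL
  obtain ⟨c, K, hK⟩ := hL
  obtain ⟨K', hK'⟩ := (IsExpBounded.shape c K).le_two_pow_sq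
  exact ⟨K', timeClass_mono hK' hK⟩

/-- **Every level `X_k`, `k ≥ 2`, is `≥ S`** — clause (c) for all but the linear-exponential pieces. [folklore] -/
theorem level_ge_S {k : ℕ} (hk : 2 ≤ k) : Level k → _root_.PneNP := fun hX =>
  Classical.byContradiction fun hS =>
    hX (DTIME_level_mono hk (E_subset_DTIME_sq (Lcode_mem_E_of_not_pneNP hS)))

/-- `L_code ∉ E` is `≥ S` … [folklore] -/
theorem not_mem_E_ge_S : Lcode ∉ E → _root_.PneNP :=
  fun h => Classical.byContradiction fun hS => h (Lcode_mem_E_of_not_pneNP hS)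

/-- … a consequence of `X` … [folklore] -/
theorem not_mem_E_of_target : Target → Lcode ∉ E :=
  fun hT hE => hT (E_subset_EXP hE)

/-- … already of level 2 … [folklore] -/
theorem not_mem_E_of_level_two : Level 2 → Lcode ∉ E :=
  fun h hE => h (E_subset_DTIME_sq hE)

/-- The linear-exponential pieces `X_{1,c} := L_code ∉ DTIME(2^{c·n})` — the only time-axis statements not
known to be `≥ S` (under `¬S`, `L_code ∈ DTIME(2^{c₀ n})` for a `c₀` inherited from the `SAT` exponent). [folklore] -/
def LinLevel (c : ℕ) : Prop := Lcode ∉ DTIME (fun n => 2 ^ (c * n))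

/-- … whose conjunction over all `c` is exactly `L_code ∉ E` (`≥ S`, and still below `X`). [folklore] -/
theorem forall_linLevel_iff_not_mem_E : (∀ c, LinLevel c) ↔ Lcode ∉ E := by
  simp only [LinLevel, E, Set.mem_iUnion, not_exists]

/-- Under `¬S` some linear-exponential level fails, with no bound on which. [folklore] -/
theorem exists_not_linLevel_of_not_pneNP (h : ¬ _root_.PneNP) : ∃ c, ¬ LinLevel c := by
  have hE := Lcode_mem_E_of_not_pneNP h
  rw [E, Set.mem_iUnion] at hE
  obtain ⟨c, hc⟩ := hE
  exact ⟨c, fun h' => h' hc⟩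

/-- §D13: the polynomial-level shadow `L_code ∉ P` ("`A(n,d)` is not polynomial-time computable") is a
CONSEQUENCE of `X` (and of every `LinLevel c`, `c ≥ 1`); nothing in the tree makes it `≥ S`. [folklore] -/
theorem not_mem_P_of_target : Target → Lcode ∉ Classes.P :=
  fun hT hP => hT (P_subset_EXP hP)

end LevelThreshold

end Summit.PneNP.PneNP.Cruxes.DelsarteLasserreTarget.DecompositionAudit
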